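import Literature.Geometry.Kaehler.ComplexTorusHodgeLieAlgebraComplexStableSubspaces
import Literature.Geometry.Kaehler.ComplexTorusEndomorphismFieldEigenspacesSymplectic
import Literature.Geometry.Kaehler.ComplexTorusEndomorphismFieldEigenspaces
import Literature.Geometry.Kaehler.ComplexTorusRealMultiplicationPrincipalPolarizations
import Literature.Algebra.Lie.Sl2TriplePlaneStandardForm
import Literature.Algebra.Lie.IrreducibleIdealCommonEigenvector
import Mathlib.NumberTheory.NumberField.InfinitePlace.Embeddings
import HarnessLib

/-!
# Moonen–Zarhin 1999 (2.2), Type I(2), the Lie algebra computation: for a polarised abelian SURFACE whose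
# endomorphism algebra is a REAL QUADRATIC FIELD `F = f(K)`, `𝔤 = Lie Hg(X)(ℂ)` contains `𝔰𝔩(V_σ) × 𝔰𝔩(V_τ)` —
# every pair of traceless endomorphisms of the two eigenplanes `V_ℂ = V_σ ⊕ V_τ` is the restriction of an
# element of `𝔤` («`Hg(X) = Res_{F/ℚ} Sp_F(V, ψ) = Res_{F/ℚ} SL_{2,F}`», the inclusion `⊇` at the Lie algebra)

Layer `Literature/Geometry/Kaehler`, namespace `Literature.Geometry.Kaehler.ComplexTorus`; lane `lit-hodgefound`
(Track 2 foundations library), Layer A4, prover seat p17 (generation 47), self-proposed row g47-#9 — the ASSEMBLY of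
the Type I(2) programme from the engines landed as g47-#4 … g47-#8.  THEOREMS ONLY (no definition, no instance, no
notation, no named fact; D-0026, net debt 0).

## The printed argument and its formalisation

Moonen–Zarhin [MZ99, (2.2)] list `Hg(X) = Res_{F/ℚ} Sp_F(V,ψ)` for Type I(2) with the remark (p0005 L46–L49) "Most
of this can be found in [21, § 2]" (Ribet) "… surfaces of Type I(2) can be handled using [4, 4.8]" (Deligne);
[MZ99, (2.3) Remark]: `hg_ℂ = 𝔨₁ ⊕ σ 𝔨₁` for a non-trivial automorphism `σ`, "it follows that `hg` is not simple.
This leaves `Hg(X) = Res_{F/ℚ} SL_{2,F}` as the only possibility".  We formalise the classical Lie-algebra route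
(Ribet's "large image" argument over `ℂ`, cf. Gordon's survey §5.8 «since `h` is semisimple … `h = sp(W₀, ℂ)`»):

1. `V_ℂ = V_σ ⊕ V_τ`, `dim V_σ = 2` (p13 `ComplexTorusEndomorphismFieldEigenspaces`: Milne's Prop. 2.1 over `ℂ`);
2. each `V_σ` is `𝔤`-stable and `𝔤`-IRREDUCIBLE (g47-#4 `ComplexTorusHodgeLieAlgebraComplexStableSubspaces` §4:
   `End_𝔤(V_ℂ) = F ⊗ ℂ` acts on `V_σ` by scalars), and `𝔤` acts on it TRACELESSLY (g47-#8
   `ComplexTorusEndomorphismFieldEigenspacesSymplectic`: `V_σ ⊥_E V_τ`, `𝔤 ⊆ 𝔩𝔣_ℂ ⊆ ∏ 𝔰𝔭(V_σ)`; the Rosati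
   involution is the identity on a totally real `F`, `rosati_eq_self_of_range_eq`);
3. hence `𝔤|V_σ = 𝔰𝔩(V_σ)` (g47-#5 `IrreducibleLinearLieAlgebraPlane`: Lie's theorem);
4. the kernels `K_τ = {Z ∈ 𝔤 | Z|V_τ = 0}` are ideals, so `K_τ|V_σ` is `0` or `𝔰𝔩(V_σ)` (g47-#7
   `IrreducibleIdealCommonEigenvector`); if some `K` is the whole `𝔰𝔩`, pairs of traceless endomorphisms lift;
5. if both kernels vanish, `𝔤` is the graph of an isomorphism `𝔰𝔩(V_σ) ≅ 𝔰𝔩(V_τ)`, which is conjugation by an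
   intertwiner `T : V_σ ⥲ V_τ` commuting with `𝔤` (g47-#6 `Sl2TriplePlaneStandardForm`); but `End_𝔤(V_ℂ) = F ⊗ ℂ`
   (p36 `forall_hodgeGroupComplexLie_comm_iff_mem_span_endAlgRat`) preserves `V_σ` — contradiction.  (This is the
   Lie-algebra form of MZ's "`hg` is not simple".)

## Sources, VERBATIM

* B. J. J. Moonen, Yu. G. Zarhin, *Hodge classes on abelian varieties of low dimension*, Math. Ann. 315 (1999),
  held `paper:arxiv-math_9901113`, §2 (2.2) (p0005 L55–L63): "Let X be a simple complex abelian surface. […]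
  Type I(2): `End⁰(X) = F` is a real quadratic field. Then there is a unique `F`-symplectic form `ψ : V × V → F` such
  that `φ = trace_{F/ℚ} ψ`. The Hodge group is given by `Hg(X) = Res_{F/ℚ} Sp_F(V,ψ)`."; (2.3) Remark (p0005
  L75–L81): "Suppose for instance that X is a simple abelian surface of Type I(2). […] Using that `V_ℂ` is the sum of
  2 copies of St, we easily find that either `Hg(X) = Res_{F/ℚ} SL_{2,F}`, or `hg_ℂ = 𝔨₁ ⊕ σ𝔨₁`. […] This leaves
  `Hg(X) = Res_{F/ℚ} SL_{2,F}` as the only possibility"; (p0006 L93–L97): "`End_{Hg(X)}(V_X) = End⁰(X)`".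
* B. B. Gordon, *A survey of the Hodge conjecture for abelian varieties* (1997), held `paper:arxiv-alg-geom_9709030`,
  §5.8 (p0017 L71–L74): "`h` […] is semisimple […] so `h = sp(W₀, ℂ)`"; Lemma 2.6 (p0011 L11–L16).
* J. S. Milne, *Lefschetz classes on abelian varieties* (1999), §2 ("Simple abelian variety of type I":
  `(V(A), φ) = ⊕ (Vᵢ, φᵢ)`, `S(A) = ∏ Res Sp(φᵢ)`; Prop. 2.1).
* J. E. Humphreys, *Introduction to Lie Algebras and Representation Theory* (1972), §4.1 (Lie's theorem), §6.

## Contents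

* §1 bookkeeping for a quadratic `K`: `sup_iInf_eigenspace_eq_top_of_finrank_eq_two` (`V_ℂ = V_σ + V_τ`),
  `isCompl_iInf_eigenspace_of_finrank_eq_two` (`V_ℂ = V_σ ⊕ V_τ`), `finrank_iInf_eigenspace_eq_two` (surfaces:
  `dim V_σ = 2`), `mul_comm_of_mem_span_endAlgRat_of_range_eq` (`F ⊗ ℂ` commutes with `f(K) ⊗ 1`).
* §2 **`IsRiemannForm.exists_mem_hodgeGroupLieC_forall_mulVec_eq_of_trace_eq_zero`** — the main theorem:
  `𝔤 ⊇ 𝔰𝔩(V_σ) × 𝔰𝔩(V_τ)` (every pair of traceless endomorphisms of `V_σ`, `V_τ` is induced by some `Z ∈ 𝔤`).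
-/

noncomputable section

open scoped Matrix
open Module Matrix
open Literature.Algebra.Lie

namespace Literature.Geometry.Kaehler

namespace ComplexTorus

/-! ## §1 Bookkeeping: `V_ℂ = V_σ ⊕ V_τ` for a quadratic field, `dim V_σ = 2` for a surface -/

section Bookkeeping

variable {ι : Type*} [Fintype ι] [DecidableEq ι] {E : Type*} [NormedAddCommGroup E] [NormedSpace ℂ E]
  {Φ : (ι → ℝ) ≃L[ℝ] E} {K : Type*} [Field K] [NumberField K] (f : K →ₐ[ℚ] Matrix ι ι ℚ)

omit [Fintype ι] [DecidableEq ι] in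
/-- A quadratic number field has exactly the two complex embeddings `σ ≠ τ`. [cite: Milne1999LefschetzClasses, §2 (`F ⊗_ℚ k = ∏ Fᵢ`)] -/
theorem ringHom_eq_or_eq_of_finrank_eq_two (hK : finrank ℚ K = 2) {σ τ : K →+* ℂ} (hστ : σ ≠ τ) (ρ : K →+* ℂ) :
    ρ = σ ∨ ρ = τ := by
  classical
  have hcard : Fintype.card (K →+* ℂ) = 2 := by rw [NumberField.Embeddings.card, hK]
  have huniv : (Finset.univ : Finset (K →+* ℂ)) = {σ, τ} := by
    symm
    apply Finset.eq_of_subset_of_card_le (Finset.subset_univ _)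
    rw [Finset.card_univ, hcard, Finset.card_pair hστ]
  have hρ : ρ ∈ ({σ, τ} : Finset (K →+* ℂ)) := huniv ▸ Finset.mem_univ ρ
  simpa [Finset.mem_insert, Finset.mem_singleton] using hρ

/-- **`V_ℂ = V_σ + V_τ` for a quadratic `K`** (`V_ℂ = ⊕_ρ V_ρ` over the two embeddings). [cite: Milne1999LefschetzClasses, §2 (`V(A) = V₁ ⊕ ⋯ ⊕ V_t`)] [cite: MoonenZarhin1998WeilClasses, §3 (3)] -/
theorem sup_iInf_eigenspace_eq_top_of_finrank_eq_two (hK : finrank ℚ K = 2) {σ τ : K →+* ℂ} (hστ : σ ≠ τ) :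
    (⨅ y : K, Module.End.eigenspace (Matrix.toLin' ((f y).map (algebraMap ℚ ℂ))) (σ y)) ⊔
      (⨅ y : K, Module.End.eigenspace (Matrix.toLin' ((f y).map (algebraMap ℚ ℂ))) (τ y)) = ⊤ := by
  refine top_le_iff.1 ?_
  rw [← iSup_iInf_eigenspace_toLin'_map_eq_top f]
  refine iSup_le fun ρ ↦ ?_
  rcases ringHom_eq_or_eq_of_finrank_eq_two hK hστ ρ with rfl | rfl
  · exact le_sup_left
  · exact le_sup_right

/-- **`V_ℂ = V_σ ⊕ V_τ` for a quadratic `K`** (the summands are independent). [cite: Milne1999LefschetzClasses, §2 (`V(A) = V₁ ⊕ ⋯ ⊕ V_t`)] [cite: MoonenZarhin1998WeilClasses, §3 (3)] -/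
theorem isCompl_iInf_eigenspace_of_finrank_eq_two (hK : finrank ℚ K = 2) {σ τ : K →+* ℂ} (hστ : σ ≠ τ) :
    IsCompl (⨅ y : K, Module.End.eigenspace (Matrix.toLin' ((f y).map (algebraMap ℚ ℂ))) (σ y))
      (⨅ y : K, Module.End.eigenspace (Matrix.toLin' ((f y).map (algebraMap ℚ ℂ))) (τ y)) :=
  isCompl_iff.2 ⟨(iSupIndep_iInf_eigenspace_toLin'_map f).pairwiseDisjoint hστ,
    codisjoint_iff.2 (sup_iInf_eigenspace_eq_top_of_finrank_eq_two f hK hστ)⟩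

/-- **`dim_ℂ V_σ = 2` for a SURFACE with multiplication by a quadratic field** (`dim V_σ · [K:ℚ] = 2g = 4`).
[cite: Milne1999LefschetzClasses, §2 Prop. 2.1] [cite: MoonenZarhin1999LowDim, §2 (2.3) ("`V_ℂ` is the sum of 2 copies of St")] -/
theorem finrank_iInf_eigenspace_eq_two [FiniteDimensional ℂ E] (Φ : (ι → ℝ) ≃L[ℝ] E) (h2 : finrank ℂ E = 2)
    (hK : finrank ℚ K = 2) (σ : K →+* ℂ) :
    finrank ℂ ↥(⨅ y : K, Module.End.eigenspace (Matrix.toLin' ((f y).map (algebraMap ℚ ℂ))) (σ y)) = 2 := by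
  have h := finrank_iInf_eigenspace_toLin'_map_mul_finrank f σ
  rw [hK, card_eq_two_mul_finrank Φ, h2] at h
  omega

/-- **`F ⊗ ℂ = span_ℂ(End⁰(X) ⊗ 1)` COMMUTES WITH `f(K) ⊗ 1`** when `End⁰(X) = f(K)` is a (commutative) field.
[cite: MoonenZarhin1999LowDim, §2 (p0006: "`End_{Hg(X)}(V_X) = End⁰(X)`")] -/
theorem mul_comm_of_mem_span_endAlgRat_of_range_eq (hfE : f.range = endAlgRat Φ) {P : Matrix ι ι ℂ}
    (hP : P ∈ Submodule.span ℂ ((fun A : Matrix ι ι ℚ ↦ A.map ((↑) : ℚ → ℂ)) '' (endAlgRat Φ : Set (Matrix ι ι ℚ))))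
    (y : K) : P * (f y).map (algebraMap ℚ ℂ) = (f y).map (algebraMap ℚ ℂ) * P := by
  induction hP using Submodule.span_induction with
  | mem Q hQ =>
    obtain ⟨A, hA, rfl⟩ := hQ
    rw [← hfE] at hA
    obtain ⟨x, rfl⟩ := (AlgHom.mem_range f).1 hA
    have hcast : (f x).map ((↑) : ℚ → ℂ) = (f x).map (algebraMap ℚ ℂ) :=
      congrArg (f x).map (funext fun q ↦ (eq_ratCast (algebraMap ℚ ℂ) q).symm)
    dsimp only
    rw [hcast, ← Matrix.map_mul, ← Matrix.map_mul, ← map_mul, ← map_mul, mul_comm x y]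
  | zero => rw [zero_mul, mul_zero]
  | add Q R _ _ hQ hR => rw [add_mul, mul_add, hQ, hR]
  | smul c Q _ hQ => rw [Matrix.smul_mul, Matrix.mul_smul, hQ]

end Bookkeeping

/-! ## §2 `𝔤 ⊇ 𝔰𝔩(V_σ) × 𝔰𝔩(V_τ)` -/

section Main

variable {ι : Type*} [Fintype ι] [DecidableEq ι] {E : Type*} [NormedAddCommGroup E] [NormedSpace ℂ E]
  [FiniteDimensional ℂ E] {Φ : (ι → ℝ) ≃L[ℝ] E} {η : E [⋀^Fin 2]→L[ℝ] ℝ} {K : Type*} [Field K] [NumberField K]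
  [NumberField.IsTotallyReal K]

/-- **Moonen–Zarhin (2.2), Type I(2), Lie algebra form: `𝔤 = Lie Hg(X)(ℂ) ⊇ 𝔰𝔩(V_σ) × 𝔰𝔩(V_τ)`.**  For a polarised
complex abelian surface `(X, E)` whose endomorphism algebra `End⁰(X) = f(K)` is a real quadratic field, with complex
embeddings `σ ≠ τ` and eigenplanes `V_σ, V_τ` (`V_ℂ = V_σ ⊕ V_τ`): for every pair `(Y₁, Y₂)` of TRACELESS
endomorphisms of `V_σ` and `V_τ` there is `Z ∈ 𝔤` with `Z|V_σ = Y₁` and `Z|V_τ = Y₂` («`Hg(X) = Res_{F/ℚ} SL_{2,F}`»: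
over `ℂ`, `Res_{F/ℚ} SL_{2,F} = SL(V_σ) × SL(V_τ)`; this is the inclusion `⊇` of Lie algebras, the inclusion `⊆` being
g47-#8's `IsRiemannForm.forall_trace_restrict_eq_zero_of_mem_hodgeGroupLieC`).
[cite: MoonenZarhin1999LowDim, §2 (2.2) ("Type I(2)": `Hg(X) = Res_{F/ℚ} Sp_F(V,ψ)`) and (2.3) Remark ("This leaves `Hg(X) = Res_{F/ℚ} SL_{2,F}` as the only possibility")]
[cite: Gordon1997, §5.8 and Lemma 2.6] -/
theorem IsRiemannForm.exists_mem_hodgeGroupLieC_forall_mulVec_eq_of_trace_eq_zero (hη : IsRiemannForm Φ η)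
    (h2 : finrank ℂ E = 2) (hK : finrank ℚ K = 2) (f : K →ₐ[ℚ] Matrix ι ι ℚ) (hfE : f.range = endAlgRat Φ)
    {σ τ : K →+* ℂ} (hστ : σ ≠ τ) {W₁ W₂ : Submodule ℂ (ι → ℂ)}
    (hW₁ : W₁ = ⨅ y : K, Module.End.eigenspace (Matrix.toLin' ((f y).map (algebraMap ℚ ℂ))) (σ y))
    (hW₂ : W₂ = ⨅ y : K, Module.End.eigenspace (Matrix.toLin' ((f y).map (algebraMap ℚ ℂ))) (τ y))
    (Y₁ : Module.End ℂ W₁) (hY₁ : LinearMap.trace ℂ W₁ Y₁ = 0) (Y₂ : Module.End ℂ W₂)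
    (hY₂ : LinearMap.trace ℂ W₂ Y₂ = 0) :
    ∃ Z ∈ hodgeGroupLieC Φ,
      (∀ w : W₁, ((Y₁ w : W₁) : ι → ℂ) = Z *ᵥ (w : ι → ℂ)) ∧ ∀ w : W₂, ((Y₂ w : W₂) : ι → ℂ) = Z *ᵥ (w : ι → ℂ) := by
  classical
  have hτσ : τ ≠ σ := fun h ↦ hστ h.symm
  have hfE' : ∀ y, f y ∈ endAlgRat Φ := fun y ↦ by rw [← hfE]; exact AlgHom.mem_range_self f y
  have hf : endAlgRat Φ ≤ f.range := le_of_eq hfE.symm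
  -- the two eigenplanes: dimensions, `V_ℂ = W₁ ⊕ W₂`
  have hd₁ : finrank ℂ W₁ = 2 := by rw [hW₁]; exact finrank_iInf_eigenspace_eq_two f Φ h2 hK σ
  have hd₂ : finrank ℂ W₂ = 2 := by rw [hW₂]; exact finrank_iInf_eigenspace_eq_two f Φ h2 hK τ
  have hsup₁₂ : W₁ ⊔ W₂ = ⊤ := by rw [hW₁, hW₂]; exact sup_iInf_eigenspace_eq_top_of_finrank_eq_two f hK hστ
  have hsup₂₁ : W₂ ⊔ W₁ = ⊤ := by rw [sup_comm, hsup₁₂]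
  have hc : IsCompl W₁ W₂ := by rw [hW₁, hW₂]; exact isCompl_iInf_eigenspace_of_finrank_eq_two f hK hστ
  -- a rational Gram matrix, and the Rosati involution is the identity on the totally real `f(K) = End⁰(X)`
  obtain ⟨G, hGη⟩ := hη.exists_ratMatrix_latticeGram
  have hcard : Fintype.card ι = 4 := by rw [card_eq_two_mul_finrank Φ, h2]
  haveI : Nonempty ι := Fintype.card_pos_iff.1 (by omega)
  have hRos : ∀ A ∈ endAlgRat Φ, rosati G A = A := fun A hA ↦
    rosati_eq_self_of_range_eq Φ f hfE hη.1 hη.2.2 hGη hA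
  -- `𝔊 = 𝔤`, transported to `End(ℂ^ι)` along `Matrix.toLin'`
  letI : LieRing (Matrix ι ι ℂ) := LieRing.ofAssociativeRing
  set 𝔊 : Submodule ℂ (Module.End ℂ (ι → ℂ)) :=
    (hodgeGroupComplexLie Φ).toSubmodule.comap
      (LinearMap.toMatrix' : Module.End ℂ (ι → ℂ) ≃ₗ[ℂ] Matrix ι ι ℂ).toLinearMap with h𝔊def
  have hmem𝔊 : ∀ Y : Module.End ℂ (ι → ℂ), Y ∈ 𝔊 ↔ LinearMap.toMatrix' Y ∈ hodgeGroupLieC Φ := fun Y ↦ by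
    rw [h𝔊def, Submodule.mem_comap, LinearEquiv.coe_coe, LieSubalgebra.mem_toSubmodule,
      mem_hodgeGroupComplexLie_iff_mem_hodgeGroupLieC]
  have htoLin : ∀ M : Matrix ι ι ℂ, Matrix.toLin' M ∈ 𝔊 ↔ M ∈ hodgeGroupLieC Φ := fun M ↦ by
    rw [hmem𝔊, LinearMap.toMatrix'_toLin']
  have hYv : ∀ (Y : Module.End ℂ (ι → ℂ)) (v : ι → ℂ), Y v = LinearMap.toMatrix' Y *ᵥ v := fun Y v ↦ by
    conv_lhs => rw [← Matrix.toLin'_toMatrix' Y]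
    rw [Matrix.toLin'_apply]
  have hbr : ∀ Y ∈ 𝔊, ∀ Y' ∈ 𝔊, Y * Y' - Y' * Y ∈ 𝔊 := fun Y hY Y' hY' ↦ by
    rw [hmem𝔊] at hY hY' ⊢
    rw [map_sub, LinearMap.toMatrix'_mul, LinearMap.toMatrix'_mul, ← Ring.lie_def]
    exact (hodgeGroupLieC Φ).lie_mem hY hY'
  -- the eigenplanes are `𝔊`-stable, `𝔊`-irreducible, and `𝔊` is traceless on them
  have hWst : ∀ (ρ : K →+* ℂ), ∀ Z ∈ 𝔊,
      ∀ w ∈ (⨅ y : K, Module.End.eigenspace (Matrix.toLin' ((f y).map (algebraMap ℚ ℂ))) (ρ y)),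
        Z w ∈ ⨅ y : K, Module.End.eigenspace (Matrix.toLin' ((f y).map (algebraMap ℚ ℂ))) (ρ y) :=
    fun ρ Z hZ w hw ↦ by
      rw [hYv Z w]
      exact mulVec_mem_iInf_eigenspace_algHom_of_mem_hodgeGroupLieC f hfE' ρ ((hmem𝔊 Z).1 hZ) hw
  have hWirr : ∀ (ρ : K →+* ℂ), ∀ U ≤ (⨅ y : K, Module.End.eigenspace (Matrix.toLin' ((f y).map (algebraMap ℚ ℂ))) (ρ y)),
      (∀ Z ∈ 𝔊, ∀ u ∈ U, Z u ∈ U) →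
        U = ⊥ ∨ U = ⨅ y : K, Module.End.eigenspace (Matrix.toLin' ((f y).map (algebraMap ℚ ℂ))) (ρ y) :=
    fun ρ U hU hst ↦ hη.eq_bot_or_eq_iInf_eigenspace_algHom_of_forall_mulVec_mem f hf ρ hU fun M hM u hu ↦ by
      have h := hst (Matrix.toLin' M) ((htoLin M).2 hM) u hu
      rwa [Matrix.toLin'_apply] at h
  have hWtr : ∀ {ρ ρ' : K →+* ℂ}, ρ ≠ ρ' →
      (⨅ y : K, Module.End.eigenspace (Matrix.toLin' ((f y).map (algebraMap ℚ ℂ))) (ρ y)) ⊔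
        (⨅ y : K, Module.End.eigenspace (Matrix.toLin' ((f y).map (algebraMap ℚ ℂ))) (ρ' y)) = ⊤ →
      ∀ (Z : Module.End ℂ (ι → ℂ)), Z ∈ 𝔊 →
        ∀ hZW : (∀ w ∈ (⨅ y : K, Module.End.eigenspace (Matrix.toLin' ((f y).map (algebraMap ℚ ℂ))) (ρ y)),
          Z w ∈ ⨅ y : K, Module.End.eigenspace (Matrix.toLin' ((f y).map (algebraMap ℚ ℂ))) (ρ y)),
        LinearMap.trace ℂ _ (Z.restrict hZW) = 0 := by
    intro ρ ρ' hρ hsup Z hZ hZW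
    obtain ⟨M, rfl⟩ : ∃ M : Matrix ι ι ℂ, Matrix.toLin' M = Z := ⟨LinearMap.toMatrix' Z, Matrix.toLin'_toMatrix' Z⟩
    exact hη.forall_trace_restrict_eq_zero_of_mem_hodgeGroupLieC f hfE' hGη hRos hρ hsup ((htoLin M).1 hZ) hZW
  have hW₁st : ∀ Z ∈ 𝔊, ∀ w ∈ W₁, Z w ∈ W₁ := by rw [hW₁]; exact hWst σ
  have hW₂st : ∀ Z ∈ 𝔊, ∀ w ∈ W₂, Z w ∈ W₂ := by rw [hW₂]; exact hWst τ
  have hW₁irr : ∀ U ≤ W₁, (∀ Z ∈ 𝔊, ∀ u ∈ U, Z u ∈ U) → U = ⊥ ∨ U = W₁ := by rw [hW₁]; exact hWirr σ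
  have hW₂irr : ∀ U ≤ W₂, (∀ Z ∈ 𝔊, ∀ u ∈ U, Z u ∈ U) → U = ⊥ ∨ U = W₂ := by rw [hW₂]; exact hWirr τ
  have hW₁tr' : ∀ (Z : Module.End ℂ (ι → ℂ)), Z ∈ 𝔊 → ∀ hZW : (∀ w ∈ W₁, Z w ∈ W₁),
      LinearMap.trace ℂ W₁ (Z.restrict hZW) = 0 := by
    have hsup : W₁ ⊔ (⨅ y : K, Module.End.eigenspace (Matrix.toLin' ((f y).map (algebraMap ℚ ℂ))) (τ y)) = ⊤ := by
      rw [← hW₂, hsup₁₂]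
    subst hW₁
    exact fun Z hZ hZW ↦ hWtr hστ hsup Z hZ hZW
  have hW₂tr' : ∀ (Z : Module.End ℂ (ι → ℂ)), Z ∈ 𝔊 → ∀ hZW : (∀ w ∈ W₂, Z w ∈ W₂),
      LinearMap.trace ℂ W₂ (Z.restrict hZW) = 0 := by
    have hsup : W₂ ⊔ (⨅ y : K, Module.End.eigenspace (Matrix.toLin' ((f y).map (algebraMap ℚ ℂ))) (σ y)) = ⊤ := by
      rw [← hW₁, hsup₂₁]
    subst hW₂
    exact fun Z hZ hZW ↦ hWtr hτσ hsup Z hZ hZW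
  have hW₁tr : ∀ Z (hZ : Z ∈ 𝔊), LinearMap.trace ℂ W₁ (Z.restrict (hW₁st Z hZ)) = 0 :=
    fun Z hZ ↦ hW₁tr' Z hZ _
  have hW₂tr : ∀ Z (hZ : Z ∈ 𝔊), LinearMap.trace ℂ W₂ (Z.restrict (hW₂st Z hZ)) = 0 :=
    fun Z hZ ↦ hW₂tr' Z hZ _
  -- the kernels `K₁ = {Z ∈ 𝔊 | Z|W₁ = 0}`, `K₂ = {Z ∈ 𝔊 | Z|W₂ = 0}`: ideals of `𝔊`
  have hkerSub : ∀ W : Submodule ℂ (ι → ℂ), (∀ Z ∈ 𝔊, ∀ w ∈ W, Z w ∈ W) →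
      ∃ S : Submodule ℂ (Module.End ℂ (ι → ℂ)), (∀ Z, Z ∈ S ↔ Z ∈ 𝔊 ∧ ∀ w ∈ W, Z w = 0) ∧ S ≤ 𝔊 ∧
        (∀ Y ∈ 𝔊, ∀ Z ∈ S, Y * Z - Z * Y ∈ S) := fun W hWS ↦ by
    refine ⟨{ carrier := {Z | Z ∈ 𝔊 ∧ ∀ w ∈ W, Z w = 0}
              add_mem' := fun {a b} ha hb ↦ ⟨add_mem ha.1 hb.1, fun w hw ↦ by
                rw [LinearMap.add_apply, ha.2 w hw, hb.2 w hw, add_zero]⟩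
              zero_mem' := ⟨zero_mem _, fun w _ ↦ rfl⟩
              smul_mem' := fun c a ha ↦ ⟨Submodule.smul_mem _ c ha.1, fun w hw ↦ by
                rw [LinearMap.smul_apply, ha.2 w hw, smul_zero]⟩ }, fun _ ↦ Iff.rfl, fun Z hZ ↦ hZ.1,
      fun Y hY Z hZ ↦ ⟨hbr Y hY Z hZ.1, fun w hw ↦ ?_⟩⟩
    rw [LinearMap.sub_apply, Module.End.mul_apply, Module.End.mul_apply, hZ.2 w hw, map_zero,
      hZ.2 (Y w) (hWS Y hY w hw), sub_zero]
  obtain ⟨K₁, hK₁, hK₁le, hK₁id⟩ := hkerSub W₁ hW₁st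
  obtain ⟨K₂, hK₂, hK₂le, hK₂id⟩ := hkerSub W₂ hW₂st
  -- the dichotomies: `K₂|W₁ ∈ {0, 𝔰𝔩(W₁)}`, `K₁|W₂ ∈ {0, 𝔰𝔩(W₂)}`
  have hdich₁ := forall_eq_zero_or_forall_exists_of_ideal_plane W₁ hd₁ 𝔊 hbr hW₁st hW₁irr K₂ hK₂le hK₂id
    fun Z hZ ↦ hW₁tr Z (hK₂le hZ)
  have hdich₂ := forall_eq_zero_or_forall_exists_of_ideal_plane W₂ hd₂ 𝔊 hbr hW₂st hW₂irr K₁ hK₁le hK₁id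
    fun Z hZ ↦ hW₂tr Z (hK₁le hZ)
  -- it suffices to produce `Z ∈ 𝔊`
  suffices h : ∃ Z ∈ 𝔊, (∀ w : W₁, ((Y₁ w : W₁) : ι → ℂ) = Z w) ∧ ∀ w : W₂, ((Y₂ w : W₂) : ι → ℂ) = Z w by
    obtain ⟨Z, hZ, h₁, h₂⟩ := h
    exact ⟨LinearMap.toMatrix' Z, (hmem𝔊 Z).1 hZ, fun w ↦ by rw [h₁ w, hYv Z], fun w ↦ by rw [h₂ w, hYv Z]⟩
  -- Case 1: `K₁|W₂ = 𝔰𝔩(W₂)`: lift `Y₁` through `𝔊` (Lie's theorem on the plane `W₁`) and correct on `W₂` inside `K₁`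
  rcases hdich₂ with hK₁zero | hK₁full
  swap
  · obtain ⟨Z₀, hZ₀, hZ₀Y⟩ := exists_mem_forall_eq_of_trace_eq_zero W₁ hd₁ 𝔊 hbr hW₁st hW₁irr hY₁
    set R : Module.End ℂ W₂ := Z₀.restrict (hW₂st Z₀ hZ₀) with hR
    have hRtr : LinearMap.trace ℂ W₂ (Y₂ - R) = 0 := by rw [(LinearMap.trace ℂ W₂).map_sub Y₂ R, hY₂, hR, hW₂tr Z₀ hZ₀, sub_zero]
    obtain ⟨Z₂, hZ₂, hZ₂Y⟩ := hK₁full (Y₂ - R) hRtr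
    refine ⟨Z₀ + Z₂, add_mem hZ₀ (hK₁le hZ₂), fun w ↦ ?_, fun w ↦ ?_⟩
    · rw [LinearMap.add_apply, ((hK₁ Z₂).1 hZ₂).2 w w.2, add_zero, hZ₀Y w]
    · have h := hZ₂Y w
      rw [LinearMap.sub_apply, Submodule.coe_sub, hR, LinearMap.coe_restrict_apply] at h
      rw [LinearMap.add_apply, ← h, add_sub_cancel]
  -- Case 2: `K₂|W₁ = 𝔰𝔩(W₁)`: symmetrically
  rcases hdich₁ with hK₂zero | hK₂full
  swap
  · obtain ⟨Z₀, hZ₀, hZ₀Y⟩ := exists_mem_forall_eq_of_trace_eq_zero W₂ hd₂ 𝔊 hbr hW₂st hW₂irr hY₂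
    set R : Module.End ℂ W₁ := Z₀.restrict (hW₁st Z₀ hZ₀) with hR
    have hRtr : LinearMap.trace ℂ W₁ (Y₁ - R) = 0 := by rw [(LinearMap.trace ℂ W₁).map_sub Y₁ R, hY₁, hR, hW₁tr Z₀ hZ₀, sub_zero]
    obtain ⟨Z₁, hZ₁, hZ₁Y⟩ := hK₂full (Y₁ - R) hRtr
    refine ⟨Z₀ + Z₁, add_mem hZ₀ (hK₂le hZ₁), fun w ↦ ?_, fun w ↦ ?_⟩
    · have h := hZ₁Y w
      rw [LinearMap.sub_apply, Submodule.coe_sub, hR, LinearMap.coe_restrict_apply] at h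
      rw [LinearMap.add_apply, ← h, add_sub_cancel]
    · rw [LinearMap.add_apply, ((hK₂ Z₁).1 hZ₁).2 w w.2, add_zero, hZ₀Y w]
  -- Case 3: both kernels act trivially: `𝔊` is a graph, conjugation by an intertwiner `T` — contradiction
  exfalso
  have hker₁ : ∀ Z ∈ 𝔊, (∀ w ∈ W₁, Z w = 0) → ∀ w ∈ W₂, Z w = 0 :=
    fun Z hZ h0 ↦ hK₁zero Z ((hK₁ Z).2 ⟨hZ, h0⟩)
  have hker₂ : ∀ Z ∈ 𝔊, (∀ w ∈ W₂, Z w = 0) → ∀ w ∈ W₁, Z w = 0 :=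
    fun Z hZ h0 ↦ hK₂zero Z ((hK₂ Z).2 ⟨hZ, h0⟩)
  obtain ⟨T, hTW₂, -, ⟨w, hw, hTw⟩, hTcomm⟩ :=
    exists_intertwiner_of_graph W₁ W₂ hd₁ hd₂ hc 𝔊 hbr hW₁st hW₂st hW₁irr hW₁tr hker₁ hker₂
  -- `T ∈ End_𝔤(V_ℂ) = F ⊗ ℂ`
  have hTspan : LinearMap.toMatrix' T ∈
      Submodule.span ℂ ((fun A : Matrix ι ι ℚ ↦ A.map ((↑) : ℚ → ℂ)) '' (endAlgRat Φ : Set (Matrix ι ι ℚ))) := by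
    refine (forall_hodgeGroupComplexLie_comm_iff_mem_span_endAlgRat Φ).1 fun M hM ↦ ?_
    have hM𝔊 : Matrix.toLin' M ∈ 𝔊 := (htoLin M).2 ((mem_hodgeGroupComplexLie_iff_mem_hodgeGroupLieC Φ).1 hM)
    have h := congrArg LinearMap.toMatrix' (hTcomm _ hM𝔊)
    rw [LinearMap.toMatrix'_mul, LinearMap.toMatrix'_mul, LinearMap.toMatrix'_toLin'] at h
    exact h.symm
  -- hence `T` preserves `W₁`; but `T(V) ⊆ W₂` and `W₁ ∩ W₂ = 0`
  have hTW₁ : T w ∈ W₁ := by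
    rw [hYv T w, hW₁]
    exact mulVec_mem_iInf_eigenspace_algHom_of_forall_mul_comm f σ
      (mul_comm_of_mem_span_endAlgRat_of_range_eq f hfE hTspan) (hW₁ ▸ hw)
  exact hTw ((Submodule.disjoint_def.1 hc.disjoint) _ hTW₁ (hTW₂ w))

end Main

end ComplexTorus

end Literature.Geometry.Kaehler
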